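import Literature.Analysis.FluidPDE.LThetaEnergyIdentities
import HarnessLib

/-!
# Vertical `L^θ` energy identities on `ℝ³` (Lemarié-Rieusset 2016, §11.5, proof of Prop. 11.6, (11.32)–(11.35))

Analysis/FluidPDE proof file (theorems only: no definition, no named fact, no `sorry`).
Search for candidate a priori estimates; no regularity claim (cell `pub-nsfunc`, literature seat:
this file formalises PUBLISHED identities; nothing new). First brick of the discharge of the named
fact `Literature.Analysis.FluidPDE.oneDirectionDerivativeCriterion`
(`GradientRegularityCriteria.lean`; P. G. Lemarié-Rieusset, *The Navier–Stokes Problem in the 21st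
Century* (2016), §11.5 Prop. 11.6, PDF pp. 357–361, "we follow the proof in Kukavica and Ziane
[289]"; I. Kukavica, M. Ziane, J. Math. Phys. 48 (2007) 065203). The printed proof runs a
Grönwall argument on `I(t) = 1 + J(t)³/2 + K(t)/6`, `J = ‖∇u₁‖₂² + ‖∇u₂‖₂²`, `K = ‖u₃‖₆⁶`; this
file supplies the `K`-part of `dI/dt`, i.e. the evaluation of `d/dt ‖u₃‖_θ^θ` (printed for
`θ = 6`, (11.32)–(11.35) and the pressure line before (11.39)):

* `∫ u₃⁵ (u·∇u₃) dx = 0` ((11.35), `div u = 0`) — here for a divergence-free `v` transporting ANY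
  field `w`: `∫ ‖w‖^{θ-2} ⟪w, (v·∇)w⟫ = 0` (`integral_norm_rpow_mul_inner_convect_eq_zero`, `θ ≥ 2`;
  for `w = v` this is the tree's `integral_inner_convect_norm_rpow_smul_eq_zero`);
* `ν∫ u₃⁵ Δu₃ = -5ν ∫ u₃⁴|∇u₃|²` ((11.33)) — the tree's `integral_inner_laplacian_norm_rpow_smul`
  applied to the vertical field `w = u₃ e₃`;
* `-∫ u₃⁵ ∂₃ϖ = 5 ∫ u₃⁴ ∂₃u₃ ϖ` (the line before (11.39)) — `∫ ⟪∇q, ‖w‖^{θ-2} w⟫ =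
  -(θ-1) ∫ q ‖w‖^{θ-2} ∂₃u₃` (`integral_inner_gradient_norm_rpow_vertical`, via the divergence
  `div(‖w‖^{θ-2} w) = (θ-1) ‖w‖^{θ-2} ∂₃u₃` of the vertical test field, `θ ≥ 4`);
* their combination along a Navier–Stokes slice `W + (v·∇)v = νΔv - ∇q`
  (`integral_norm_rpow_vertical_inner_eq_of_momentum`):
  `θ ∫ ‖w‖^{θ-2}⟪w, W⟫ = -νθ ∫ (‖w‖^{θ-2}|∇w|²_F + (θ-2)‖w‖^{θ-4} Σⱼ⟪w, ∂ⱼw⟫²)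
   + θ(θ-1) ∫ q ‖w‖^{θ-2} ∂₃u₃`, `w = ⟪e₃, v⟫ e₃` — the density of
  `IsSmoothSpaceTimeOn.lTheta_balance` for the vertical part of the velocity, evaluated.

All fields are classical slices of Tao's `L²`-Sobolev class (`C¹`/`C²`, bounded, with
`v, Dv, D²v, q, Dq ∈ L²`), exactly as in `LThetaEnergyIdentities.lean`, whose pointwise helpers
are repeated here (they are private there). The direction is any coordinate direction `e i` of
`EuclideanSpace ℝ (Fin 3)` (`i = 2` is the printed `x₃`).

## References

* [LemarieRieusset2016] P. G. Lemarié-Rieusset, *The Navier–Stokes Problem in the 21st Century*,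
  CRC Press 2016, §11.5, proof of Prop. 11.6, (11.31)–(11.35) and the display before (11.39)
  (held text, PDF pp. 357–360).
* [KukavicaZiane2007] I. Kukavica, M. Ziane, *Navier–Stokes equations with regularity in one
  direction*, J. Math. Phys. 48 (2007) 065203.
-/

noncomputable section

open MeasureTheory Set Function Filter Topology InnerProductSpace
open scoped ENNReal NNReal ContDiff RealInnerProductSpace Laplacian

namespace Literature.Analysis.FluidPDE

section Pointwise

/-- `‖a‖^p = (‖a‖²)^{p/2}`. [folklore] -/
private theorem norm_rpow_eq_sq_rpow_v (a : EuclideanSpace ℝ (Fin 3)) (p : ℝ) :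
    ‖a‖ ^ p = (‖a‖ ^ 2) ^ (p / 2) := by
  rw [← Real.rpow_natCast ‖a‖ 2, ← Real.rpow_mul (norm_nonneg _)]
  congr 1
  push_cast
  ring

/-- Differentiability of `y ↦ ‖w y‖^p`, `p ≥ 2`, at a point of differentiability of `w`, with
`D(‖w‖^p)(x) h = p ‖w x‖^{p-2} ⟪w x, Dw(x) h⟫`. [folklore] -/
private theorem fderiv_norm_rpow_apply_v
    {w : EuclideanSpace ℝ (Fin 3) → EuclideanSpace ℝ (Fin 3)}
    {x : EuclideanSpace ℝ (Fin 3)} (hd : DifferentiableAt ℝ w x) {p : ℝ} (hp : 2 ≤ p) :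
    DifferentiableAt ℝ (fun y => ‖w y‖ ^ p) x ∧
      ∀ h, fderiv ℝ (fun y => ‖w y‖ ^ p) x h = p * ‖w x‖ ^ (p - 2) * ⟪w x, fderiv ℝ w x h⟫ := by
  have h1 := hd.hasFDerivAt.norm_sq
  have h2 := h1.rpow_const (p := p / 2) (Or.inr (by linarith))
  have h3 : HasFDerivAt (fun y => ‖w y‖ ^ p) _ x :=
    h2.congr_of_eventuallyEq (Eventually.of_forall fun y => norm_rpow_eq_sq_rpow_v (w y) p)
  refine ⟨h3.differentiableAt, fun h => ?_⟩
  rw [h3.fderiv]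
  simp [innerSL_apply_apply]
  rw [norm_rpow_eq_sq_rpow_v (w x) (p - 2)]
  have : (p - 2) / 2 = p / 2 - 1 := by ring
  rw [this]
  ring

/-- `y ↦ ‖w y‖^p` is `C¹` for `w ∈ C¹` and `p ≥ 2`. [folklore] -/
private theorem contDiff_norm_rpow_v {w : EuclideanSpace ℝ (Fin 3) → EuclideanSpace ℝ (Fin 3)}
    (hw : ContDiff ℝ 1 w) {p : ℝ} (hp : 2 ≤ p) : ContDiff ℝ 1 (fun y => ‖w y‖ ^ p) := by
  have h : ContDiff ℝ 1 (fun y => (‖w y‖ ^ 2) ^ (p / 2)) :=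
    (hw.norm_sq ℝ).rpow_const_of_le (by norm_cast; linarith)
  have hfun : (fun y => ‖w y‖ ^ p) = fun y => (‖w y‖ ^ 2) ^ (p / 2) :=
    funext fun y => norm_rpow_eq_sq_rpow_v (w y) p
  rw [hfun]
  exact h

/-- The derivative of the test field `‖w‖^{θ-2} w` (`θ ≥ 4`):
`D(‖w‖^{θ-2} w)(x) h = ‖w x‖^{θ-2} Dw(x) h + (θ-2) ‖w x‖^{θ-4} ⟪w x, Dw(x) h⟫ w x`. [folklore] -/
private theorem fderiv_norm_rpow_smul_apply_v
    {w : EuclideanSpace ℝ (Fin 3) → EuclideanSpace ℝ (Fin 3)} (hw : ContDiff ℝ 1 w)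
    {θ : ℝ} (hθ : 4 ≤ θ) (x h : EuclideanSpace ℝ (Fin 3)) :
    DifferentiableAt ℝ (fun y => ‖w y‖ ^ (θ - 2) • w y) x ∧
    fderiv ℝ (fun y => ‖w y‖ ^ (θ - 2) • w y) x h = ‖w x‖ ^ (θ - 2) • fderiv ℝ w x h +
      ((θ - 2) * ‖w x‖ ^ (θ - 4) * ⟪w x, fderiv ℝ w x h⟫) • w x := by
  have hdW : ∀ y, DifferentiableAt ℝ w y := fun y => (hw.differentiable (by simp)) y
  obtain ⟨hdiff, happ⟩ := fderiv_norm_rpow_apply_v (hdW x) (p := θ - 2) (by linarith)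
  refine ⟨hdiff.smul (hdW x), ?_⟩
  rw [fderiv_fun_smul hdiff (hdW x)]
  simp only [add_apply, ContinuousLinearMap.smulRight_apply, happ h]
  have : θ - 2 - 2 = θ - 4 := by ring
  rw [this]
  rfl

/-- `‖‖w‖^{θ-2} w‖ ≤ B^{θ-2} ‖w‖` when `‖w‖ ≤ B`. [folklore] -/
private theorem norm_norm_rpow_smul_le_v
    {w : EuclideanSpace ℝ (Fin 3) → EuclideanSpace ℝ (Fin 3)} {θ : ℝ} (hθ : 2 ≤ θ)
    {B : ℝ} (hB : ∀ x, ‖w x‖ ≤ B) (y : EuclideanSpace ℝ (Fin 3)) :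
    ‖‖w y‖ ^ (θ - 2) • w y‖ ≤ ‖(B ^ (θ - 2)) • w y‖ := by
  have hB0 : 0 ≤ B := (norm_nonneg _).trans (hB y)
  rw [norm_smul, norm_smul, Real.norm_of_nonneg (Real.rpow_nonneg (norm_nonneg _) _),
    Real.norm_of_nonneg (Real.rpow_nonneg hB0 _)]
  exact mul_le_mul_of_nonneg_right (Real.rpow_le_rpow (norm_nonneg _) (hB y) (by linarith))
    (norm_nonneg _)

/-- `‖D(‖w‖^{θ-2} w)(y) h‖ ≤ (θ-1) B^{θ-2} ‖Dw(y) h‖` when `‖w‖ ≤ B`, `θ ≥ 4`. [folklore] -/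
private theorem norm_fderiv_norm_rpow_smul_apply_le_v
    {w : EuclideanSpace ℝ (Fin 3) → EuclideanSpace ℝ (Fin 3)} (hw : ContDiff ℝ 1 w)
    {θ : ℝ} (hθ : 4 ≤ θ) {B : ℝ} (hB : ∀ x, ‖w x‖ ≤ B) (y h : EuclideanSpace ℝ (Fin 3)) :
    ‖fderiv ℝ (fun y => ‖w y‖ ^ (θ - 2) • w y) y h‖ ≤
      ‖((θ - 1) * B ^ (θ - 2)) • fderiv ℝ w y h‖ := by
  have hB0 : 0 ≤ B := (norm_nonneg _).trans (hB y)
  have hpowB : ‖w y‖ ^ (θ - 2) ≤ B ^ (θ - 2) :=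
    Real.rpow_le_rpow (norm_nonneg _) (hB y) (by linarith)
  have hsplit : ‖w y‖ ^ (θ - 4) * ‖w y‖ * ‖w y‖ = ‖w y‖ ^ (θ - 2) := by
    rw [mul_assoc, ← sq, ← Real.rpow_natCast (‖w y‖) 2,
      ← Real.rpow_add' (norm_nonneg _) (by push_cast; linarith)]
    congr 1
    push_cast
    ring
  rw [(fderiv_norm_rpow_smul_apply_v hw hθ y h).2, norm_smul, Real.norm_of_nonneg (by
    have : 0 ≤ B ^ (θ - 2) := Real.rpow_nonneg hB0 _
    nlinarith)]
  have h1 : ‖‖w y‖ ^ (θ - 2) • fderiv ℝ w y h‖ = ‖w y‖ ^ (θ - 2) * ‖fderiv ℝ w y h‖ := by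
    rw [norm_smul, Real.norm_of_nonneg (Real.rpow_nonneg (norm_nonneg _) _)]
  have h2 : ‖((θ - 2) * ‖w y‖ ^ (θ - 4) * ⟪w y, fderiv ℝ w y h⟫) • w y‖ ≤
      (θ - 2) * ‖w y‖ ^ (θ - 2) * ‖fderiv ℝ w y h‖ := by
    rw [norm_smul, norm_mul, norm_mul, Real.norm_of_nonneg (by linarith : (0:ℝ) ≤ θ - 2),
      Real.norm_of_nonneg (Real.rpow_nonneg (norm_nonneg _) _)]
    calc (θ - 2) * ‖w y‖ ^ (θ - 4) * ‖⟪w y, fderiv ℝ w y h⟫‖ * ‖w y‖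
        ≤ (θ - 2) * ‖w y‖ ^ (θ - 4) * (‖w y‖ * ‖fderiv ℝ w y h‖) * ‖w y‖ := by
          have h0 : 0 ≤ (θ - 2) * ‖w y‖ ^ (θ - 4) :=
            mul_nonneg (by linarith) (Real.rpow_nonneg (norm_nonneg _) _)
          exact mul_le_mul_of_nonneg_right
            (mul_le_mul_of_nonneg_left (norm_inner_le_norm _ _) h0) (norm_nonneg _)
      _ = (θ - 2) * (‖w y‖ ^ (θ - 4) * ‖w y‖ * ‖w y‖) * ‖fderiv ℝ w y h‖ := by ring
      _ = (θ - 2) * ‖w y‖ ^ (θ - 2) * ‖fderiv ℝ w y h‖ := by rw [hsplit]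
  calc ‖‖w y‖ ^ (θ - 2) • fderiv ℝ w y h + ((θ - 2) * ‖w y‖ ^ (θ - 4) * ⟪w y, fderiv ℝ w y h⟫) • w y‖
      ≤ ‖w y‖ ^ (θ - 2) * ‖fderiv ℝ w y h‖ + (θ - 2) * ‖w y‖ ^ (θ - 2) * ‖fderiv ℝ w y h‖ := by
          refine (norm_add_le _ _).trans ?_
          rw [h1]
          exact add_le_add le_rfl h2
    _ = (θ - 1) * (‖w y‖ ^ (θ - 2) * ‖fderiv ℝ w y h‖) := by ring
    _ ≤ (θ - 1) * (B ^ (θ - 2) * ‖fderiv ℝ w y h‖) :=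
        mul_le_mul_of_nonneg_left (mul_le_mul_of_nonneg_right hpowB (norm_nonneg _)) (by linarith)
    _ = (θ - 1) * B ^ (θ - 2) * ‖fderiv ℝ w y h‖ := by ring

/-- `L²` finiteness is preserved by constant scalings. [folklore] -/
private theorem lintegral_enorm_sq_smul_lt_top_v
    {f : EuclideanSpace ℝ (Fin 3) → EuclideanSpace ℝ (Fin 3)} (c : ℝ)
    (hf : ∫⁻ x, ‖f x‖ₑ ^ 2 < ⊤) : ∫⁻ x, ‖c • f x‖ₑ ^ 2 < ⊤ := by
  have : ∀ x, ‖c • f x‖ₑ ^ 2 = ‖c‖ₑ ^ 2 * ‖f x‖ₑ ^ 2 := fun x => by rw [enorm_smul, mul_pow]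
  simp_rw [this]
  rw [lintegral_const_mul' _ _ (by simp)]
  exact ENNReal.mul_lt_top (by simp) hf

end Pointwise

/-! ### Transport of `‖w‖^θ` by a divergence-free field: `∫ ‖w‖^{θ-2}⟪w, (v·∇)w⟫ = 0` -/

section Transport

/-- **The convection term does not see the `L^θ` energy of a transported field**
(Lemarié-Rieusset 2016, proof of Prop. 11.6, (11.35): "Integration by parts gives (since
`div u = 0`) `A = -5∫u₃⁵ u·∇u₃ dx = -∫ u₃ u·∇(u₃⁵) dx = -5A = 0`"; proof of Prop. 11.7, (11.46)
and (11.53) for `w = u`). For `C¹` fields `v, w` on `ℝ³` with `v` divergence free, `w` bounded,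
`v, Dv, w, Dw ∈ L²`, and a real exponent `θ ≥ 2`: `∫ ‖w‖^{θ-2} ⟪w, (v·∇)w⟫ = 0`. Proof:
pointwise `‖w‖^{θ-2}⟪w, (v·∇)w⟫ = ⟪∇F, v⟫` with `F = θ⁻¹‖w‖^θ`, and `∫ ⟪∇F, v⟫ = 0` for
divergence-free `v` (`integral_inner_gradient_eq_zero_of_isDivFree_R3`).
[cite: LemarieRieusset2016, §11.5 Prop. 11.6 proof, (11.35) (PDF p. 358)] -/
theorem integral_norm_rpow_mul_inner_convect_eq_zero
    {v w : EuclideanSpace ℝ (Fin 3) → EuclideanSpace ℝ (Fin 3)} (hv : ContDiff ℝ 1 v)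
    (hw : ContDiff ℝ 1 w) (hdiv : VectorCalculus.IsDivFree v) {θ : ℝ} (hθ : 2 ≤ θ)
    {B : ℝ} (hB : ∀ x, ‖w x‖ ≤ B)
    (hv0 : ∫⁻ x, ‖v x‖ₑ ^ 2 < ⊤) (hv1 : ∫⁻ x, ‖iteratedFDeriv ℝ 1 v x‖ₑ ^ 2 < ⊤)
    (hw0 : ∫⁻ x, ‖w x‖ₑ ^ 2 < ⊤) (hw1 : ∫⁻ x, ‖iteratedFDeriv ℝ 1 w x‖ₑ ^ 2 < ⊤) :
    ∫ x, ‖w x‖ ^ (θ - 2) * ⟪w x, FluidPDE.convect v w x⟫ = 0 := by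
  set e := EuclideanSpace.basisFun (Fin 3) ℝ with he
  have he1 : ∀ i, ‖e i‖ = 1 := fun i => by simp [he]
  have hB0 : 0 ≤ B := (norm_nonneg _).trans (hB 0)
  have hθ0 : 0 < θ := by linarith
  have hdW : ∀ y, DifferentiableAt ℝ w y := fun y => (hw.differentiable (by simp)) y
  -- the potential `F = θ⁻¹ ‖w‖^θ`
  set F : EuclideanSpace ℝ (Fin 3) → ℝ := fun y => θ⁻¹ * ‖w y‖ ^ θ with hFdef
  have hFc : ContDiff ℝ 1 F := contDiff_const.mul (contDiff_norm_rpow_v hw hθ)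
  have hdF : ∀ y h, fderiv ℝ F y h = ‖w y‖ ^ (θ - 2) * ⟪w y, fderiv ℝ w y h⟫ := by
    intro y h
    obtain ⟨hdiff, happ⟩ := fderiv_norm_rpow_apply_v (hdW y) hθ
    rw [hFdef]
    rw [fderiv_const_mul hdiff,
      show (θ⁻¹ • fderiv ℝ (fun y => ‖w y‖ ^ θ) y) h = θ⁻¹ * fderiv ℝ (fun y => ‖w y‖ ^ θ) y h
        from rfl, happ h]
    field_simp
  -- the integrand is `⟪∇F, v⟫`
  have hpt : ∀ y, ‖w y‖ ^ (θ - 2) * ⟪w y, FluidPDE.convect v w y⟫ = ⟪gradient F y, v y⟫ := by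
    intro y
    rw [gradient, InnerProductSpace.toDual_symm_apply, hdF, FluidPDE.convect]
  simp_rw [hpt]
  -- continuity and `L²` bookkeeping
  have cv : Continuous v := hv.continuous
  have cw : Continuous w := hw.continuous
  have cDv : Continuous (fderiv ℝ v) := hv.continuous_fderiv (by simp)
  have cdiv : ∀ i, Continuous fun x => fderiv ℝ v x (e i) := fun i => cDv.clm_apply continuous_const
  have cDw : Continuous (fderiv ℝ w) := hw.continuous_fderiv (by simp)
  have cdiw : ∀ i, Continuous fun x => fderiv ℝ w x (e i) := fun i => cDw.clm_apply continuous_const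
  have cF : Continuous F := hFc.continuous
  have cdF : ∀ i, Continuous fun x => fderiv ℝ F x (e i) := fun i =>
    (hFc.continuous_fderiv (by simp)).clm_apply continuous_const
  have cBdw : ∀ i, Continuous fun x => (B ^ (θ - 1)) • fderiv ℝ w x (e i) := fun i =>
    (cdiw i).const_smul (B ^ (θ - 1))
  have cBw : Continuous fun x => (θ⁻¹ * B ^ (θ - 1)) • w x := cw.const_smul (θ⁻¹ * B ^ (θ - 1))
  have l2div : ∀ i, ∫⁻ x, ‖fderiv ℝ v x (e i)‖ₑ ^ 2 < ⊤ := fun i =>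
    lintegral_enorm_sq_lt_top_of_norm_le (fun x => norm_fderiv_apply_basisFun_le v x i) hv1
  have l2diw : ∀ i, ∫⁻ x, ‖fderiv ℝ w x (e i)‖ₑ ^ 2 < ⊤ := fun i =>
    lintegral_enorm_sq_lt_top_of_norm_le (fun x => norm_fderiv_apply_basisFun_le w x i) hw1
  -- pointwise bounds: `‖w‖^{θ-2} ‖w‖ = ‖w‖^{θ-1} ≤ B^{θ-1}`, `F ≤ θ⁻¹ B^{θ-1} ‖w‖`
  have hpow1 : ∀ y, ‖w y‖ ^ (θ - 2) * ‖w y‖ ≤ B ^ (θ - 1) := by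
    intro y
    have h1 : ‖w y‖ ^ (θ - 2) * ‖w y‖ = ‖w y‖ ^ (θ - 1) := by
      conv_rhs => rw [show θ - 1 = (θ - 2) + 1 by ring]
      rw [Real.rpow_add' (norm_nonneg _) (by linarith), Real.rpow_one]
    rw [h1]
    exact Real.rpow_le_rpow (norm_nonneg _) (hB y) (by linarith)
  have hpow2 : ∀ y, ‖w y‖ ^ θ ≤ B ^ (θ - 1) * ‖w y‖ := by
    intro y
    have h1 : ‖w y‖ ^ θ = ‖w y‖ ^ (θ - 1) * ‖w y‖ := by
      conv_lhs => rw [show θ = (θ - 1) + 1 by ring]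
      rw [Real.rpow_add' (norm_nonneg _) (by linarith), Real.rpow_one]
    rw [h1]
    exact mul_le_mul_of_nonneg_right (Real.rpow_le_rpow (norm_nonneg _) (hB y) (by linarith))
      (norm_nonneg _)
  have hin : ∀ i (y : EuclideanSpace ℝ (Fin 3)), ‖⟪e i, y⟫‖ ≤ ‖y‖ := fun i y =>
    (norm_inner_le_norm (𝕜 := ℝ) (e i) y).trans (by rw [he1, one_mul])
  have hdFle : ∀ i y, ‖fderiv ℝ F y (e i)‖ ≤ ‖(B ^ (θ - 1)) • fderiv ℝ w y (e i)‖ := by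
    intro i y
    rw [hdF, norm_mul, Real.norm_of_nonneg (Real.rpow_nonneg (norm_nonneg _) _), norm_smul,
      Real.norm_of_nonneg (Real.rpow_nonneg hB0 _)]
    calc ‖w y‖ ^ (θ - 2) * ‖⟪w y, fderiv ℝ w y (e i)⟫‖
        ≤ ‖w y‖ ^ (θ - 2) * (‖w y‖ * ‖fderiv ℝ w y (e i)‖) :=
          mul_le_mul_of_nonneg_left (norm_inner_le_norm _ _) (Real.rpow_nonneg (norm_nonneg _) _)
      _ = (‖w y‖ ^ (θ - 2) * ‖w y‖) * ‖fderiv ℝ w y (e i)‖ := by ring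
      _ ≤ B ^ (θ - 1) * ‖fderiv ℝ w y (e i)‖ :=
          mul_le_mul_of_nonneg_right (hpow1 y) (norm_nonneg _)
  have hFle : ∀ y, ‖F y‖ ≤ ‖(θ⁻¹ * B ^ (θ - 1)) • w y‖ := by
    intro y
    rw [hFdef]
    simp only
    rw [norm_mul, norm_smul, Real.norm_of_nonneg (inv_nonneg.2 hθ0.le),
      Real.norm_of_nonneg (Real.rpow_nonneg (norm_nonneg _) _), Real.norm_of_nonneg (by positivity),
      mul_assoc]
    exact mul_le_mul_of_nonneg_left (hpow2 y) (inv_nonneg.2 hθ0.le)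
  refine integral_inner_gradient_eq_zero_of_isDivFree_R3 hFc hv hdiv (fun i => ?_) (fun i => ?_)
    (fun i => ?_)
  · -- `⟪eᵢ, v⟫ ∂ᵢF`
    refine integrable_of_norm_le_mul_of_lintegral_sq
      ((continuous_const.inner cv).mul (cdF i)).aestronglyMeasurable cv (cBdw i) hv0
      (lintegral_enorm_sq_smul_lt_top_v _ (l2diw i)) fun y => ?_
    rw [norm_mul]
    exact mul_le_mul (hin i _) (hdFle i y) (norm_nonneg _) (norm_nonneg _)
  · -- `⟪eᵢ, ∂ᵢv⟫ F`
    refine integrable_of_norm_le_mul_of_lintegral_sq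
      ((continuous_const.inner (cdiv i)).mul cF).aestronglyMeasurable (cdiv i) cBw (l2div i)
      (lintegral_enorm_sq_smul_lt_top_v _ hw0) fun y => ?_
    rw [norm_mul]
    exact mul_le_mul (hin i _) (hFle y) (norm_nonneg _) (norm_nonneg _)
  · -- `⟪eᵢ, v⟫ F`
    refine integrable_of_norm_le_mul_of_lintegral_sq
      ((continuous_const.inner cv).mul cF).aestronglyMeasurable cv cBw hv0
      (lintegral_enorm_sq_smul_lt_top_v _ hw0) fun y => ?_
    rw [norm_mul]
    exact mul_le_mul (hin i _) (hFle y) (norm_nonneg _) (norm_nonneg _)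

end Transport

/-! ### Integration by parts against a gradient and the divergence of `‖w‖^{θ-2} w` -/

section Divergence

/-- Integration by parts `∫ ⟪∇q, w⟫ = -∫ q div w` on `ℝ³` for `C¹` fields with the three
coordinate pairings integrable (coordinatewise, Mathlib
`integral_mul_fderiv_eq_neg_fderiv_mul_of_integrable`; copy of the private lemma of
`LThetaEnergyIdentities`). [folklore] -/
private theorem integral_inner_gradient_eq_neg_integral_mul_divergence_v
    {q : EuclideanSpace ℝ (Fin 3) → ℝ} {w : EuclideanSpace ℝ (Fin 3) → EuclideanSpace ℝ (Fin 3)}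
    (hq : ContDiff ℝ 1 q) (hw : ContDiff ℝ 1 w)
    (h1 : ∀ i, Integrable (fun x => ⟪EuclideanSpace.basisFun (Fin 3) ℝ i, w x⟫ *
      fderiv ℝ q x (EuclideanSpace.basisFun (Fin 3) ℝ i)) volume)
    (h2 : ∀ i, Integrable (fun x => ⟪EuclideanSpace.basisFun (Fin 3) ℝ i,
      fderiv ℝ w x (EuclideanSpace.basisFun (Fin 3) ℝ i)⟫ * q x) volume)
    (h3 : ∀ i, Integrable (fun x => ⟪EuclideanSpace.basisFun (Fin 3) ℝ i, w x⟫ * q x) volume) :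
    ∫ x, ⟪gradient q x, w x⟫ = -∫ x, q x * VectorCalculus.divergence w x := by
  set e := EuclideanSpace.basisFun (Fin 3) ℝ with he
  have hdq : Differentiable ℝ q := hq.differentiable one_ne_zero
  have hdwi : ∀ i, Differentiable ℝ (fun y => ⟪e i, w y⟫) := fun i =>
    ((innerSL ℝ (e i)).differentiable).comp (hw.differentiable one_ne_zero)
  have hderiv : ∀ i x, fderiv ℝ (fun y => ⟪e i, w y⟫) x (e i) = ⟪e i, fderiv ℝ w x (e i)⟫ :=
    fun i x => fderiv_inner_const_left_apply_of_contDiff hw (e i) x (e i)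
  have hIBP : ∀ i, ∫ x, ⟪e i, w x⟫ * fderiv ℝ q x (e i) =
      - ∫ x, ⟪e i, fderiv ℝ w x (e i)⟫ * q x := by
    intro i
    have h2' : Integrable (fun x => fderiv ℝ (fun y => ⟪e i, w y⟫) x (e i) * q x) volume := by
      simp_rw [hderiv]; exact h2 i
    have := integral_mul_fderiv_eq_neg_fderiv_mul_of_integrable (μ := volume)
      (f := fun y => ⟪e i, w y⟫) (g := q) (v := e i) h2' (h1 i) (h3 i)
      (fun x _ => hdwi i x) (fun x _ => hdq x)
    rw [this]
    simp_rw [hderiv]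
  have hsum : (fun x => ⟪gradient q x, w x⟫) = fun x => ∑ i, ⟪e i, w x⟫ * fderiv ℝ q x (e i) :=
    funext fun x => inner_gradient_eq_sum_basisFun q x (w x)
  rw [hsum, integral_finsetSum _ fun i _ => h1 i]
  simp_rw [hIBP]
  rw [Finset.sum_neg_distrib, ← integral_finsetSum _ fun i _ => h2 i]
  congr 1
  refine integral_congr_ae (Eventually.of_forall fun x => ?_)
  simp only
  rw [FluidPDE.divergence_eq_sum_inner_fderiv e w x, Finset.mul_sum]
  exact Finset.sum_congr rfl fun i _ => by ring

/-- **The divergence of the test field** `‖w‖^{θ-2} w` (`θ ≥ 4`, no constraint on `w`):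
`div (‖w‖^{θ-2} w) = ‖w‖^{θ-2} div w + (θ-2) ‖w‖^{θ-4} ⟪w, (w·∇)w⟫` (the tree's
`divergence_norm_rpow_smul` is the divergence-free case). [folklore] -/
private theorem divergence_norm_rpow_smul_eq
    {w : EuclideanSpace ℝ (Fin 3) → EuclideanSpace ℝ (Fin 3)} (hw : ContDiff ℝ 1 w)
    {θ : ℝ} (hθ : 4 ≤ θ) (x : EuclideanSpace ℝ (Fin 3)) :
    VectorCalculus.divergence (fun y => ‖w y‖ ^ (θ - 2) • w y) x =
      ‖w x‖ ^ (θ - 2) * VectorCalculus.divergence w x +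
        (θ - 2) * ‖w x‖ ^ (θ - 4) * ⟪w x, FluidPDE.convect w w x⟫ := by
  set e := EuclideanSpace.basisFun (Fin 3) ℝ with he
  rw [FluidPDE.divergence_eq_sum_inner_fderiv e]
  have hdW : ∀ i, fderiv ℝ (fun y => ‖w y‖ ^ (θ - 2) • w y) x (e i) =
      ‖w x‖ ^ (θ - 2) • fderiv ℝ w x (e i) +
        ((θ - 2) * ‖w x‖ ^ (θ - 4) * ⟪w x, fderiv ℝ w x (e i)⟫) • w x := fun i =>
    (fderiv_norm_rpow_smul_apply_v hw hθ x (e i)).2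
  simp_rw [hdW, inner_add_right, inner_smul_right, Finset.sum_add_distrib, ← Finset.mul_sum]
  rw [← FluidPDE.divergence_eq_sum_inner_fderiv e w x]
  -- `Σᵢ (c ⟪w, ∂ᵢw⟫) ⟪eᵢ, w⟫ = c ⟪w, Dw(w)⟫`
  have hrepr : ∑ i, ⟪e i, w x⟫ • e i = w x := e.sum_repr' (w x)
  have hDw : fderiv ℝ w x (w x) = ∑ i, ⟪e i, w x⟫ • fderiv ℝ w x (e i) := by
    calc fderiv ℝ w x (w x) = fderiv ℝ w x (∑ i, ⟪e i, w x⟫ • e i) := by rw [hrepr]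
      _ = ∑ i, ⟪e i, w x⟫ • fderiv ℝ w x (e i) := by
          rw [map_sum]
          exact Finset.sum_congr rfl fun i _ => by rw [map_smul]
  have hlin : ∑ i, ⟪w x, fderiv ℝ w x (e i)⟫ * ⟪e i, w x⟫ = ⟪w x, FluidPDE.convect w w x⟫ := by
    rw [FluidPDE.convect, hDw, inner_sum]
    exact Finset.sum_congr rfl fun i _ => by rw [inner_smul_right, mul_comm]
  rw [← hlin, Finset.mul_sum]
  congr 1
  exact Finset.sum_congr rfl fun i _ => by ring

end Divergence

/-! ### The vertical part `w = ⟪e₃, v⟫ e₃` of a field: pointwise calculus -/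

section Vertical

/-- The vertical part `x ↦ ⟪eᵢ, v x⟫ eᵢ` is the composition of `v` with the rank-one map
`Lᵢ a = ⟪eᵢ, a⟫ eᵢ`, a continuous linear map of norm `1`. [folklore] -/
private theorem vertical_eq_comp
    {v w : EuclideanSpace ℝ (Fin 3) → EuclideanSpace ℝ (Fin 3)} {i : Fin 3}
    (hw : ∀ x, w x = ⟪EuclideanSpace.basisFun (Fin 3) ℝ i, v x⟫ • EuclideanSpace.basisFun (Fin 3) ℝ i) :
    w = ⇑((innerSL ℝ (EuclideanSpace.basisFun (Fin 3) ℝ i)).smulRight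
      (EuclideanSpace.basisFun (Fin 3) ℝ i)) ∘ v := by
  funext x
  rw [Function.comp_apply, ContinuousLinearMap.smulRight_apply, innerSL_apply_apply, hw x]

/-- The rank-one map `Lᵢ a = ⟪eᵢ, a⟫ eᵢ` has operator norm at most `1`. [folklore] -/
private theorem norm_vertical_clm_le (i : Fin 3) :
    ‖(innerSL ℝ (EuclideanSpace.basisFun (Fin 3) ℝ i)).smulRight
      (EuclideanSpace.basisFun (Fin 3) ℝ i)‖ ≤ 1 := by
  rw [ContinuousLinearMap.norm_smulRight_apply, innerSL_apply_norm]
  simp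

/-- `‖⟪eᵢ, a⟫ eᵢ‖ = |⟪eᵢ, a⟫| ≤ ‖a‖`. [folklore] -/
private theorem norm_inner_basisFun_smul_le (i : Fin 3) (a : EuclideanSpace ℝ (Fin 3)) :
    ‖⟪EuclideanSpace.basisFun (Fin 3) ℝ i, a⟫ • EuclideanSpace.basisFun (Fin 3) ℝ i‖ ≤ ‖a‖ := by
  have he1 : ‖EuclideanSpace.basisFun (Fin 3) ℝ i‖ = 1 := by simp
  rw [norm_smul, he1, mul_one]
  exact (norm_inner_le_norm _ _).trans (by rw [he1, one_mul])

/-- The vertical part only pairs with vertical parts: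
`⟪⟪eᵢ, a⟫ eᵢ, ⟪eᵢ, g⟫ eᵢ⟫ = ⟪⟪eᵢ, a⟫ eᵢ, g⟫`. [folklore] -/
private theorem inner_basisFun_smul_basisFun_smul (i : Fin 3) (a g : EuclideanSpace ℝ (Fin 3)) :
    ⟪⟪EuclideanSpace.basisFun (Fin 3) ℝ i, a⟫ • EuclideanSpace.basisFun (Fin 3) ℝ i,
      ⟪EuclideanSpace.basisFun (Fin 3) ℝ i, g⟫ • EuclideanSpace.basisFun (Fin 3) ℝ i⟫ =
      ⟪⟪EuclideanSpace.basisFun (Fin 3) ℝ i, a⟫ • EuclideanSpace.basisFun (Fin 3) ℝ i, g⟫ := by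
  have he1 : ‖EuclideanSpace.basisFun (Fin 3) ℝ i‖ = 1 := by simp
  rw [real_inner_smul_left, real_inner_smul_left, real_inner_smul_right,
    real_inner_self_eq_norm_sq, he1]
  ring

variable {v w : EuclideanSpace ℝ (Fin 3) → EuclideanSpace ℝ (Fin 3)} {i : Fin 3}

/-- The vertical part of a `Cⁿ` field is `Cⁿ`. (component calculus `u₃ = ⟪e₃, u⟫`, `∂ₜu₃`, `Δu₃`, `u·∇u₃` of the printed computation)
[cite: LemarieRieusset2016, §11.5 Prop. 11.6 proof, (11.31)–(11.33) (PDF p. 358)] -/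
theorem contDiff_vertical {n : WithTop ℕ∞} (hv : ContDiff ℝ n v)
    (hw : ∀ x, w x = ⟪EuclideanSpace.basisFun (Fin 3) ℝ i, v x⟫ • EuclideanSpace.basisFun (Fin 3) ℝ i) :
    ContDiff ℝ n w := by
  rw [vertical_eq_comp hw]
  exact (ContinuousLinearMap.contDiff _).comp hv

/-- The derivative of the vertical part: `Dw(x) h = ⟪eᵢ, Dv(x) h⟫ eᵢ`. (component calculus `u₃ = ⟪e₃, u⟫`, `∂ₜu₃`, `Δu₃`, `u·∇u₃` of the printed computation)
[cite: LemarieRieusset2016, §11.5 Prop. 11.6 proof, (11.31)–(11.33) (PDF p. 358)] -/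
theorem fderiv_vertical_apply (hv : ContDiff ℝ 1 v)
    (hw : ∀ x, w x = ⟪EuclideanSpace.basisFun (Fin 3) ℝ i, v x⟫ • EuclideanSpace.basisFun (Fin 3) ℝ i)
    (x h : EuclideanSpace ℝ (Fin 3)) :
    fderiv ℝ w x h = ⟪EuclideanSpace.basisFun (Fin 3) ℝ i, fderiv ℝ v x h⟫ •
      EuclideanSpace.basisFun (Fin 3) ℝ i := by
  set L := (innerSL ℝ (EuclideanSpace.basisFun (Fin 3) ℝ i)).smulRight
      (EuclideanSpace.basisFun (Fin 3) ℝ i) with hL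
  have hd : DifferentiableAt ℝ v x := (hv.differentiable (by simp)) x
  rw [vertical_eq_comp hw, (L.hasFDerivAt.comp x hd.hasFDerivAt).fderiv]
  rw [ContinuousLinearMap.comp_apply, hL, ContinuousLinearMap.smulRight_apply, innerSL_apply_apply]

/-- The Sobolev densities of the vertical part are dominated by those of the field:
`‖Dⁿw(x)‖ ≤ ‖Dⁿv(x)‖`. (component calculus `u₃ = ⟪e₃, u⟫`, `∂ₜu₃`, `Δu₃`, `u·∇u₃` of the printed computation)
[cite: LemarieRieusset2016, §11.5 Prop. 11.6 proof, (11.31)–(11.33) (PDF p. 358)] -/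
theorem norm_iteratedFDeriv_vertical_le {N : WithTop ℕ∞} (hv : ContDiff ℝ N v)
    (hw : ∀ x, w x = ⟪EuclideanSpace.basisFun (Fin 3) ℝ i, v x⟫ • EuclideanSpace.basisFun (Fin 3) ℝ i)
    (n : ℕ) (hn : (n : WithTop ℕ∞) ≤ N) (x : EuclideanSpace ℝ (Fin 3)) :
    ‖iteratedFDeriv ℝ n w x‖ ≤ ‖iteratedFDeriv ℝ n v x‖ := by
  set L := (innerSL ℝ (EuclideanSpace.basisFun (Fin 3) ℝ i)).smulRight
      (EuclideanSpace.basisFun (Fin 3) ℝ i) with hL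
  rw [vertical_eq_comp hw, L.iteratedFDeriv_comp_left (hv.of_le hn).contDiffAt (i := n) le_rfl]
  refine (ContinuousLinearMap.norm_compContinuousMultilinearMap_le _ _).trans ?_
  calc ‖L‖ * ‖iteratedFDeriv ℝ n v x‖ ≤ 1 * ‖iteratedFDeriv ℝ n v x‖ :=
        mul_le_mul_of_nonneg_right (norm_vertical_clm_le i) (norm_nonneg _)
    _ = ‖iteratedFDeriv ℝ n v x‖ := one_mul _

/-- The Laplacian of the vertical part: `Δw(x) = ⟪eᵢ, Δv(x)⟫ eᵢ`. (component calculus `u₃ = ⟪e₃, u⟫`, `∂ₜu₃`, `Δu₃`, `u·∇u₃` of the printed computation)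
[cite: LemarieRieusset2016, §11.5 Prop. 11.6 proof, (11.31)–(11.33) (PDF p. 358)] -/
theorem laplacian_vertical (hv : ContDiff ℝ 2 v)
    (hw : ∀ x, w x = ⟪EuclideanSpace.basisFun (Fin 3) ℝ i, v x⟫ • EuclideanSpace.basisFun (Fin 3) ℝ i)
    (x : EuclideanSpace ℝ (Fin 3)) :
    (Δ w) x = ⟪EuclideanSpace.basisFun (Fin 3) ℝ i, (Δ v) x⟫ • EuclideanSpace.basisFun (Fin 3) ℝ i := by
  rw [vertical_eq_comp hw, (hv.contDiffAt (x := x)).laplacian_CLM_comp_left]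
  rw [Function.comp_apply, ContinuousLinearMap.smulRight_apply, innerSL_apply_apply]

/-- The convective derivative of the vertical part is the vertical part of the convective
derivative: `(a·∇)w (x) = ⟪eᵢ, (a·∇)v (x)⟫ eᵢ`. (component calculus `u₃ = ⟪e₃, u⟫`, `∂ₜu₃`, `Δu₃`, `u·∇u₃` of the printed computation)
[cite: LemarieRieusset2016, §11.5 Prop. 11.6 proof, (11.31)–(11.33) (PDF p. 358)] -/
theorem convect_vertical (hv : ContDiff ℝ 1 v)
    (hw : ∀ x, w x = ⟪EuclideanSpace.basisFun (Fin 3) ℝ i, v x⟫ • EuclideanSpace.basisFun (Fin 3) ℝ i)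
    (a : EuclideanSpace ℝ (Fin 3) → EuclideanSpace ℝ (Fin 3)) (x : EuclideanSpace ℝ (Fin 3)) :
    FluidPDE.convect a w x = ⟪EuclideanSpace.basisFun (Fin 3) ℝ i, FluidPDE.convect a v x⟫ •
      EuclideanSpace.basisFun (Fin 3) ℝ i := by
  rw [FluidPDE.convect, FluidPDE.convect, fderiv_vertical_apply hv hw]

/-- The divergence of the vertical part: `div w (x) = ⟪eᵢ, Dv(x) eᵢ⟫` (`= ∂ᵢvᵢ`). [folklore] -/
private theorem divergence_vertical (hv : ContDiff ℝ 1 v)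
    (hw : ∀ x, w x = ⟪EuclideanSpace.basisFun (Fin 3) ℝ i, v x⟫ • EuclideanSpace.basisFun (Fin 3) ℝ i)
    (x : EuclideanSpace ℝ (Fin 3)) :
    VectorCalculus.divergence w x =
      ⟪EuclideanSpace.basisFun (Fin 3) ℝ i, fderiv ℝ v x (EuclideanSpace.basisFun (Fin 3) ℝ i)⟫ := by
  set e := EuclideanSpace.basisFun (Fin 3) ℝ with he
  rw [FluidPDE.divergence_eq_sum_inner_fderiv e w x]
  have horth : ∀ j, ⟪e j, e i⟫ = if j = i then (1 : ℝ) else 0 := fun j =>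
    orthonormal_iff_ite.1 e.orthonormal j i
  have hterm : ∀ j, ⟪e j, fderiv ℝ w x (e j)⟫ =
      if j = i then ⟪e i, fderiv ℝ v x (e i)⟫ else 0 := by
    intro j
    rw [fderiv_vertical_apply hv hw, real_inner_smul_right, horth j]
    split_ifs with hji
    · rw [hji, mul_one]
    · rw [mul_zero]
  simp_rw [hterm]
  rw [Finset.sum_ite_eq' Finset.univ i]
  simp

/-- The self-convection of the vertical part pairs with it as
`⟪w, (w·∇)w⟫ (x) = ‖w x‖² ⟪eᵢ, Dv(x) eᵢ⟫`. [folklore] -/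
private theorem inner_convect_vertical_self (hv : ContDiff ℝ 1 v)
    (hw : ∀ x, w x = ⟪EuclideanSpace.basisFun (Fin 3) ℝ i, v x⟫ • EuclideanSpace.basisFun (Fin 3) ℝ i)
    (x : EuclideanSpace ℝ (Fin 3)) :
    ⟪w x, FluidPDE.convect w w x⟫ =
      ‖w x‖ ^ 2 * ⟪EuclideanSpace.basisFun (Fin 3) ℝ i,
        fderiv ℝ v x (EuclideanSpace.basisFun (Fin 3) ℝ i)⟫ := by
  set e := EuclideanSpace.basisFun (Fin 3) ℝ with he
  have he1 : ‖e i‖ = 1 := by simp [he]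
  rw [FluidPDE.convect, fderiv_vertical_apply hv hw, hw x, map_smul, real_inner_smul_right,
    real_inner_smul_left, real_inner_smul_right, real_inner_self_eq_norm_sq, he1,
    norm_smul, he1, Real.norm_eq_abs, mul_one, sq_abs]
  ring

/-- **The divergence of the vertical test field**:
`div (‖w‖^{θ-2} w) (x) = (θ-1) ‖w x‖^{θ-2} ⟪eᵢ, Dv(x) eᵢ⟫` for `w = ⟪eᵢ, v⟫ eᵢ`, `θ ≥ 4`
(`d/ds (|s|^{θ-2} s) = (θ-1)|s|^{θ-2}`, the integration by parts `-∫u₃⁵∂₃ϖ = 5∫u₃⁴∂₃u₃ϖ`).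
[cite: LemarieRieusset2016, §11.5 Prop. 11.6 proof, display before (11.39) (PDF p. 360)] -/
theorem divergence_norm_rpow_smul_vertical (hv : ContDiff ℝ 1 v)
    (hw : ∀ x, w x = ⟪EuclideanSpace.basisFun (Fin 3) ℝ i, v x⟫ • EuclideanSpace.basisFun (Fin 3) ℝ i)
    {θ : ℝ} (hθ : 4 ≤ θ) (x : EuclideanSpace ℝ (Fin 3)) :
    VectorCalculus.divergence (fun y => ‖w y‖ ^ (θ - 2) • w y) x =
      (θ - 1) * ‖w x‖ ^ (θ - 2) * ⟪EuclideanSpace.basisFun (Fin 3) ℝ i,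
        fderiv ℝ v x (EuclideanSpace.basisFun (Fin 3) ℝ i)⟫ := by
  have hw1 : ContDiff ℝ 1 w := contDiff_vertical hv hw
  rw [divergence_norm_rpow_smul_eq hw1 hθ x, divergence_vertical hv hw x,
    inner_convect_vertical_self hv hw x]
  have hsplit : ‖w x‖ ^ (θ - 4) * ‖w x‖ ^ 2 = ‖w x‖ ^ (θ - 2) := by
    rw [← Real.rpow_natCast (‖w x‖) 2, ← Real.rpow_add' (norm_nonneg _) (by norm_num; linarith)]
    norm_num
    ring_nf
  calc ‖w x‖ ^ (θ - 2) * ⟪EuclideanSpace.basisFun (Fin 3) ℝ i,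
          fderiv ℝ v x (EuclideanSpace.basisFun (Fin 3) ℝ i)⟫ +
        (θ - 2) * ‖w x‖ ^ (θ - 4) * (‖w x‖ ^ 2 * ⟪EuclideanSpace.basisFun (Fin 3) ℝ i,
          fderiv ℝ v x (EuclideanSpace.basisFun (Fin 3) ℝ i)⟫)
      = (‖w x‖ ^ (θ - 2) + (θ - 2) * (‖w x‖ ^ (θ - 4) * ‖w x‖ ^ 2)) *
          ⟪EuclideanSpace.basisFun (Fin 3) ℝ i, fderiv ℝ v x (EuclideanSpace.basisFun (Fin 3) ℝ i)⟫ := by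
        ring
    _ = (θ - 1) * ‖w x‖ ^ (θ - 2) * ⟪EuclideanSpace.basisFun (Fin 3) ℝ i,
          fderiv ℝ v x (EuclideanSpace.basisFun (Fin 3) ℝ i)⟫ := by
        rw [hsplit]; ring

end Vertical

/-! ### The pressure term against the vertical test field, and the vertical `L^θ` rate -/

section VerticalSlice

variable {v w : EuclideanSpace ℝ (Fin 3) → EuclideanSpace ℝ (Fin 3)} {i : Fin 3}

/-- `L²` facts of the vertical part, inherited from the field. [folklore] -/
private theorem vertical_l2 {N : WithTop ℕ∞} (hv : ContDiff ℝ N v)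
    (hw : ∀ x, w x = ⟪EuclideanSpace.basisFun (Fin 3) ℝ i, v x⟫ • EuclideanSpace.basisFun (Fin 3) ℝ i)
    (n : ℕ) (hn : (n : WithTop ℕ∞) ≤ N) (hvn : ∫⁻ x, ‖iteratedFDeriv ℝ n v x‖ₑ ^ 2 < ⊤) :
    ∫⁻ x, ‖iteratedFDeriv ℝ n w x‖ₑ ^ 2 < ⊤ :=
  lintegral_enorm_sq_lt_top_of_norm_le (fun x => norm_iteratedFDeriv_vertical_le hv hw n hn x) hvn

/-- **The pressure term against the vertical test field, integrated by parts**
(Lemarié-Rieusset 2016, proof of Prop. 11.6, the line before (11.39):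
"`-∫ u₃⁵ ∂₃ϖ dx = 5 ∫ u₃⁴ ∂₃u₃ ϖ dx`"). For `q ∈ C¹`, a `C¹` bounded field `v` on `ℝ³` with
`q, Dq, v, Dv ∈ L²`, the vertical part `w = ⟪eᵢ, v⟫ eᵢ` and `θ ≥ 4`:
`∫ ⟪∇q, ‖w‖^{θ-2} w⟫ = -(θ-1) ∫ q ‖w‖^{θ-2} ⟪eᵢ, Dv eᵢ⟫` (`∫ ⟪∇q, W⟫ = -∫ q div W` with
`div(‖w‖^{θ-2} w) = (θ-1)‖w‖^{θ-2} ∂ᵢvᵢ`, `divergence_norm_rpow_smul_vertical`).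
[cite: LemarieRieusset2016, §11.5 Prop. 11.6 proof, display before (11.39) (PDF p. 360)] -/
theorem integral_inner_gradient_norm_rpow_smul_vertical
    {q : EuclideanSpace ℝ (Fin 3) → ℝ} (hq : ContDiff ℝ 1 q) (hv : ContDiff ℝ 1 v)
    (hw : ∀ x, w x = ⟪EuclideanSpace.basisFun (Fin 3) ℝ i, v x⟫ • EuclideanSpace.basisFun (Fin 3) ℝ i)
    {θ : ℝ} (hθ : 4 ≤ θ) {B : ℝ} (hB : ∀ x, ‖v x‖ ≤ B)
    (hv0 : ∫⁻ x, ‖v x‖ₑ ^ 2 < ⊤) (hv1 : ∫⁻ x, ‖iteratedFDeriv ℝ 1 v x‖ₑ ^ 2 < ⊤)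
    (hq0 : ∫⁻ x, ‖q x‖ₑ ^ 2 < ⊤) (hq1 : ∫⁻ x, ‖iteratedFDeriv ℝ 1 q x‖ₑ ^ 2 < ⊤) :
    ∫ x, ⟪gradient q x, ‖w x‖ ^ (θ - 2) • w x⟫ =
      -((θ - 1) * ∫ x, q x * (‖w x‖ ^ (θ - 2) * ⟪EuclideanSpace.basisFun (Fin 3) ℝ i,
        fderiv ℝ v x (EuclideanSpace.basisFun (Fin 3) ℝ i)⟫)) := by
  set e := EuclideanSpace.basisFun (Fin 3) ℝ with he
  have he1 : ∀ j, ‖e j‖ = 1 := fun j => by simp [he]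
  have hθ2 : 2 ≤ θ - 2 := by linarith
  have hw1 : ContDiff ℝ 1 w := contDiff_vertical hv hw
  have hBw : ∀ x, ‖w x‖ ≤ B := fun x => by
    rw [hw x]; exact (norm_inner_basisFun_smul_le i (v x)).trans (hB x)
  have hB0 : 0 ≤ B := (norm_nonneg _).trans (hB 0)
  have hw0 : ∫⁻ x, ‖w x‖ₑ ^ 2 < ⊤ := by
    refine lintegral_enorm_sq_lt_top_of_norm_le (fun x => ?_) hv0
    rw [hw x]; exact norm_inner_basisFun_smul_le i (v x)
  -- the test field
  set W : EuclideanSpace ℝ (Fin 3) → EuclideanSpace ℝ (Fin 3) := fun y => ‖w y‖ ^ (θ - 2) • w y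
    with hWdef
  have hW : ContDiff ℝ 1 W := (contDiff_norm_rpow_v hw1 hθ2).smul hw1
  -- continuity and `L²` bookkeeping
  have cv : Continuous v := hv.continuous
  have cwf : Continuous w := hw1.continuous
  have cdw : ∀ j, Continuous fun x => fderiv ℝ w x (e j) := fun j =>
    (hw1.continuous_fderiv (by simp)).clm_apply continuous_const
  have cW : Continuous W := hW.continuous
  have cdW : ∀ j, Continuous fun x => fderiv ℝ W x (e j) := fun j =>
    (hW.continuous_fderiv (by simp)).clm_apply continuous_const
  have cq : Continuous q := hq.continuous
  have cdq : ∀ j, Continuous fun x => fderiv ℝ q x (e j) := fun j =>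
    (hq.continuous_fderiv (by simp)).clm_apply continuous_const
  have l2dw : ∀ j, ∫⁻ x, ‖fderiv ℝ w x (e j)‖ₑ ^ 2 < ⊤ := by
    intro j
    refine lintegral_enorm_sq_lt_top_of_norm_le (fun x => ?_) hv1
    rw [fderiv_vertical_apply hv hw]
    exact (norm_inner_basisFun_smul_le i _).trans (norm_fderiv_apply_basisFun_le v x j)
  have l2dq : ∀ j, ∫⁻ x, ‖fderiv ℝ q x (e j)‖ₑ ^ 2 < ⊤ := fun j =>
    lintegral_enorm_sq_lt_top_of_norm_le (fun x => norm_fderiv_apply_basisFun_le q x j) hq1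
  have hWle : ∀ y, ‖W y‖ ≤ ‖(B ^ (θ - 2)) • w y‖ := fun y =>
    norm_norm_rpow_smul_le_v (by linarith) hBw y
  have hdWle : ∀ j y, ‖fderiv ℝ W y (e j)‖ ≤ ‖((θ - 1) * B ^ (θ - 2)) • fderiv ℝ w y (e j)‖ :=
    fun j y => norm_fderiv_norm_rpow_smul_apply_le_v hw1 hθ hBw y (e j)
  have cBw : Continuous fun x => (B ^ (θ - 2)) • w x := cwf.const_smul (B ^ (θ - 2))
  have cBdw : ∀ j, Continuous fun x => ((θ - 1) * B ^ (θ - 2)) • fderiv ℝ w x (e j) := fun j =>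
    (cdw j).const_smul ((θ - 1) * B ^ (θ - 2))
  have hin : ∀ j (y : EuclideanSpace ℝ (Fin 3)), ‖⟪e j, y⟫‖ ≤ ‖y‖ := fun j y =>
    (norm_inner_le_norm (𝕜 := ℝ) (e j) y).trans (by rw [he1, one_mul])
  -- the three pairings
  have h1 : ∀ j, Integrable (fun x => ⟪e j, W x⟫ * fderiv ℝ q x (e j)) volume := fun j =>
    integrable_of_norm_le_mul_of_lintegral_sq
      ((continuous_const.inner cW).mul (cdq j)).aestronglyMeasurable cBw (cdq j)
      (lintegral_enorm_sq_smul_lt_top_v _ hw0) (l2dq j) fun x => by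
        rw [norm_mul]
        exact mul_le_mul_of_nonneg_right ((hin j _).trans (hWle x)) (norm_nonneg _)
  have h2 : ∀ j, Integrable (fun x => ⟪e j, fderiv ℝ W x (e j)⟫ * q x) volume := fun j =>
    integrable_of_norm_le_mul_of_lintegral_sq
      ((continuous_const.inner (cdW j)).mul cq).aestronglyMeasurable (cBdw j) cq
      (lintegral_enorm_sq_smul_lt_top_v _ (l2dw j)) hq0 fun x => by
        rw [norm_mul]
        exact mul_le_mul_of_nonneg_right ((hin j _).trans (hdWle j x)) (norm_nonneg _)
  have h3 : ∀ j, Integrable (fun x => ⟪e j, W x⟫ * q x) volume := fun j =>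
    integrable_of_norm_le_mul_of_lintegral_sq
      ((continuous_const.inner cW).mul cq).aestronglyMeasurable cBw cq
      (lintegral_enorm_sq_smul_lt_top_v _ hw0) hq0 fun x => by
        rw [norm_mul]
        exact mul_le_mul_of_nonneg_right ((hin j _).trans (hWle x)) (norm_nonneg _)
  have hIBP := integral_inner_gradient_eq_neg_integral_mul_divergence_v hq hW h1 h2 h3
  have hWx : ∀ x, W x = ‖w x‖ ^ (θ - 2) • w x := fun x => rfl
  simp_rw [← hWx]
  rw [hIBP, ← integral_const_mul]
  congr 1
  refine integral_congr_ae (Eventually.of_forall fun x => ?_)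
  simp only
  rw [hWdef, divergence_norm_rpow_smul_vertical hv hw hθ x]
  ring

/-- **The `L^θ` energy rate of the vertical part of the velocity along a Navier–Stokes time
slice** (Lemarié-Rieusset 2016, proof of Prop. 11.6, (11.32)–(11.35) and the pressure line
before (11.39), printed for `θ = 6`: `d/dt ‖u₃‖₆⁶/6 = ν∫u₃⁵Δu₃ - ∫u₃⁵ u·∇u₃ - ∫u₃⁵∂₃ϖ`,
`ν∫u₃⁵Δu₃ = -(5/9)ν‖∇(u₃³)‖₂²`, `∫u₃⁵u·∇u₃ = 0`, `-∫u₃⁵∂₃ϖ = 5∫u₃⁴∂₃u₃ ϖ`). Let `v : ℝ³ → ℝ³`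
be `C²`, bounded and divergence free, `q : ℝ³ → ℝ` be `C¹` and `W : ℝ³ → ℝ³` any field with
the momentum equation `W + (v·∇)v = νΔv - ∇q`, and `v, Dv, D²v, q, Dq ∈ L²`; let
`w = ⟪eᵢ, v⟫ eᵢ` be the vertical part and `θ ≥ 4`. Then
`θ ∫ ‖w‖^{θ-2} ⟪w, W⟫ = -νθ ∫ (‖w‖^{θ-2}|∇w|²_F + (θ-2)‖w‖^{θ-4} Σⱼ⟪w, ∂ⱼw⟫²)
  + θ(θ-1) ∫ q ‖w‖^{θ-2} ⟪eᵢ, Dv eᵢ⟫`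
(the density `θ‖w‖^{θ-2}⟪w, ∂ₜw⟫ = θ‖w‖^{θ-2}⟪w, ∂ₜv⟫` of `IsSmoothSpaceTimeOn.lTheta_balance`
for the vertical part, evaluated with `integral_inner_laplacian_norm_rpow_smul`,
`integral_norm_rpow_mul_inner_convect_eq_zero` and
`integral_inner_gradient_norm_rpow_smul_vertical`). For `θ = 6` and `w = u₃e₃` the right side is
`-6ν∫(u₃⁴|∇u₃|² + 4u₃⁴|∇u₃|²) + 30∫ϖ u₃⁴∂₃u₃`, the printed value times `6`.
[cite: LemarieRieusset2016, §11.5 Prop. 11.6 proof, (11.32)–(11.35) (PDF pp. 358–360)] -/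
theorem integral_norm_rpow_vertical_inner_eq_of_momentum {ν : ℝ}
    {W : EuclideanSpace ℝ (Fin 3) → EuclideanSpace ℝ (Fin 3)} {q : EuclideanSpace ℝ (Fin 3) → ℝ}
    (hv : ContDiff ℝ 2 v) (hq : ContDiff ℝ 1 q)
    (hmom : ∀ x, W x + FluidPDE.convect v v x = ν • (Δ v) x - gradient q x)
    (hdiv : VectorCalculus.IsDivFree v)
    (hw : ∀ x, w x = ⟪EuclideanSpace.basisFun (Fin 3) ℝ i, v x⟫ • EuclideanSpace.basisFun (Fin 3) ℝ i)
    {B : ℝ} (hB : ∀ x, ‖v x‖ ≤ B) {θ : ℝ} (hθ : 4 ≤ θ)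
    (hv0 : ∫⁻ x, ‖v x‖ₑ ^ 2 < ⊤) (hv1 : ∫⁻ x, ‖iteratedFDeriv ℝ 1 v x‖ₑ ^ 2 < ⊤)
    (hv2 : ∫⁻ x, ‖iteratedFDeriv ℝ 2 v x‖ₑ ^ 2 < ⊤)
    (hq0 : ∫⁻ x, ‖q x‖ₑ ^ 2 < ⊤) (hq1 : ∫⁻ x, ‖iteratedFDeriv ℝ 1 q x‖ₑ ^ 2 < ⊤) :
    ∫ x, θ * ‖w x‖ ^ (θ - 2) * ⟪w x, W x⟫ =
      -(ν * θ) * (∫ x, (‖w x‖ ^ (θ - 2) * FluidPDE.frobeniusNormSq (fderiv ℝ w x) +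
          (θ - 2) * ‖w x‖ ^ (θ - 4) *
            ∑ j, ⟪w x, fderiv ℝ w x (EuclideanSpace.basisFun (Fin 3) ℝ j)⟫ ^ 2)) +
        θ * (θ - 1) * ∫ x, q x * (‖w x‖ ^ (θ - 2) *
          ⟪EuclideanSpace.basisFun (Fin 3) ℝ i, fderiv ℝ v x (EuclideanSpace.basisFun (Fin 3) ℝ i)⟫) := by
  set e := EuclideanSpace.basisFun (Fin 3) ℝ with he
  have hB0 : 0 ≤ B := (norm_nonneg _).trans (hB 0)
  have hθ2 : 2 ≤ θ - 2 := by linarith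
  have hv1' : ContDiff ℝ 1 v := hv.of_le (by norm_num)
  have hw2 : ContDiff ℝ 2 w := contDiff_vertical hv hw
  have hw1' : ContDiff ℝ 1 w := contDiff_vertical hv1' hw
  have hBw : ∀ x, ‖w x‖ ≤ B := fun x => by
    rw [hw x]; exact (norm_inner_basisFun_smul_le i (v x)).trans (hB x)
  have hw0 : ∫⁻ x, ‖w x‖ₑ ^ 2 < ⊤ := by
    refine lintegral_enorm_sq_lt_top_of_norm_le (fun x => ?_) hv0
    rw [hw x]; exact norm_inner_basisFun_smul_le i (v x)
  have hw1 : ∫⁻ x, ‖iteratedFDeriv ℝ 1 w x‖ₑ ^ 2 < ⊤ := vertical_l2 hv hw 1 (by norm_num) hv1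
  have hw2' : ∫⁻ x, ‖iteratedFDeriv ℝ 2 w x‖ₑ ^ 2 < ⊤ := vertical_l2 hv hw 2 (by norm_num) hv2
  -- the three identities, with the weight pulled out of the inner products
  have hI1 := integral_inner_laplacian_norm_rpow_smul hw2 hθ hBw hw0 hw1 hw2'
  have hI2 := integral_norm_rpow_mul_inner_convect_eq_zero hv1' hw1' hdiv (by linarith : (2:ℝ) ≤ θ)
    hBw hv0 hv1 hw0 hw1
  have hI3 := integral_inner_gradient_norm_rpow_smul_vertical hq hv1' hw hθ hB hv0 hv1 hq0 hq1
  have hsm : ∀ (a : EuclideanSpace ℝ (Fin 3)) x, ⟪a, ‖w x‖ ^ (θ - 2) • w x⟫ =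
      ‖w x‖ ^ (θ - 2) * ⟪w x, a⟫ := fun a x => by
    rw [inner_smul_right, real_inner_comm]
  simp_rw [hsm] at hI1 hI3
  -- rewrite `W` through the momentum equation, and project on the vertical part
  have hWx : ∀ x, W x = ν • (Δ v) x - FluidPDE.convect v v x - gradient q x := by
    intro x
    have h : W x = ν • (Δ v) x - gradient q x - FluidPDE.convect v v x :=
      eq_sub_iff_add_eq.2 (hmom x)
    rw [h]; abel
  have hproj : ∀ (g : EuclideanSpace ℝ (Fin 3)) x, ⟪w x, ⟪e i, g⟫ • e i⟫ = ⟪w x, g⟫ := by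
    intro g x
    rw [hw x]
    exact inner_basisFun_smul_basisFun_smul i (v x) g
  have hΔ : ∀ x, ⟪w x, (Δ v) x⟫ = ⟪w x, (Δ w) x⟫ := fun x => by
    rw [laplacian_vertical hv hw x, hproj]
  have hconv : ∀ x, ⟪w x, FluidPDE.convect v v x⟫ = ⟪w x, FluidPDE.convect v w x⟫ := fun x => by
    rw [convect_vertical hv1' hw v x, hproj]
  have hpt : ∀ x, θ * ‖w x‖ ^ (θ - 2) * ⟪w x, W x⟫ =
      θ * (ν * (‖w x‖ ^ (θ - 2) * ⟪w x, (Δ w) x⟫) - ‖w x‖ ^ (θ - 2) * ⟪w x, FluidPDE.convect v w x⟫ -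
        ‖w x‖ ^ (θ - 2) * ⟪w x, gradient q x⟫) := by
    intro x
    rw [hWx, inner_sub_right, inner_sub_right, inner_smul_right, hΔ, hconv]
    ring
  -- continuity and `L²` bookkeeping
  have cv : Continuous v := hv.continuous
  have cwf : Continuous w := hw2.continuous
  have cDv : Continuous (fderiv ℝ v) := hv.continuous_fderiv (by simp)
  have cDw : Continuous (fderiv ℝ w) := hw2.continuous_fderiv (by simp)
  have hΔc : Continuous (Δ w) := FluidPDE.continuous_laplacian hw2
  have cpow : Continuous fun x => ‖w x‖ ^ (θ - 2) := (contDiff_norm_rpow_v hw1' hθ2).continuous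
  have cBw : Continuous fun x => (B ^ (θ - 2)) • w x := cwf.const_smul (B ^ (θ - 2))
  have hpowB : ∀ y, ‖w y‖ ^ (θ - 2) ≤ B ^ (θ - 2) := fun y =>
    Real.rpow_le_rpow (norm_nonneg _) (hBw y) (by linarith)
  -- `|‖w‖^{θ-2} ⟪w, a⟫| ≤ ‖a‖ ‖B^{θ-2} • w‖`
  have hwt : ∀ (a : EuclideanSpace ℝ (Fin 3)) x, ‖‖w x‖ ^ (θ - 2) * ⟪w x, a⟫‖ ≤
      ‖a‖ * ‖(B ^ (θ - 2)) • w x‖ := by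
    intro a x
    rw [norm_mul, Real.norm_of_nonneg (Real.rpow_nonneg (norm_nonneg _) _), norm_smul,
      Real.norm_of_nonneg (Real.rpow_nonneg hB0 _)]
    calc ‖w x‖ ^ (θ - 2) * ‖⟪w x, a⟫‖ ≤ B ^ (θ - 2) * (‖w x‖ * ‖a‖) :=
          mul_le_mul (hpowB x) (norm_inner_le_norm _ _) (norm_nonneg _) (Real.rpow_nonneg hB0 _)
      _ = ‖a‖ * (B ^ (θ - 2) * ‖w x‖) := by ring
  have l2Bw : ∫⁻ x, ‖(B ^ (θ - 2)) • w x‖ₑ ^ 2 < ⊤ := lintegral_enorm_sq_smul_lt_top_v _ hw0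
  have n_Δ : ∀ x, ‖(Δ w) x‖ ≤ ‖(3 : ℝ) • iteratedFDeriv ℝ 2 v x‖ := fun x => by
    rw [norm_smul, Real.norm_of_nonneg (by norm_num : (0 : ℝ) ≤ 3)]
    exact (norm_laplacian_le_three_mul_norm_iteratedFDeriv_two hw2 x).trans
      (mul_le_mul_of_nonneg_left (norm_iteratedFDeriv_vertical_le hv hw 2 (by norm_num) x)
        (by norm_num))
  have c3D2 : Continuous fun x => (3 : ℝ) • iteratedFDeriv ℝ 2 v x :=
    (hv.continuous_iteratedFDeriv (by norm_num)).const_smul (3 : ℝ)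
  have l2Δ : ∫⁻ x, ‖(3 : ℝ) • iteratedFDeriv ℝ 2 v x‖ₑ ^ 2 < ⊤ := by
    have : ∀ x, ‖(3 : ℝ) • iteratedFDeriv ℝ 2 v x‖ₑ ^ 2 =
        ENNReal.ofReal (3 ^ 2) * ‖iteratedFDeriv ℝ 2 v x‖ₑ ^ 2 := by
      intro x
      rw [enorm_smul, mul_pow, Real.enorm_eq_ofReal (by norm_num : (0:ℝ) ≤ 3),
        ENNReal.ofReal_pow (by norm_num : (0:ℝ) ≤ 3)]
    simp_rw [this]
    rw [lintegral_const_mul' _ _ ENNReal.ofReal_ne_top]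
    exact ENNReal.mul_lt_top ENNReal.ofReal_lt_top hv2
  have cconv : Continuous (FluidPDE.convect v w) := cDw.clm_apply cv
  have cBDv : Continuous fun x => B • fderiv ℝ v x := cDv.const_smul B
  have n_conv : ∀ x, ‖FluidPDE.convect v w x‖ ≤ ‖B • fderiv ℝ v x‖ := fun x => by
    rw [FluidPDE.convect, fderiv_vertical_apply hv1' hw]
    refine (norm_inner_basisFun_smul_le i _).trans ?_
    rw [norm_smul, Real.norm_of_nonneg hB0, mul_comm]
    exact (fderiv ℝ v x).le_opNorm_of_le (hB x)
  have hDv_eq : ∀ x, ‖fderiv ℝ v x‖ = ‖iteratedFDeriv ℝ 1 v x‖ := fun x => by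
    rw [← norm_iteratedFDeriv_fderiv, norm_iteratedFDeriv_zero]
  have l2Dv : ∫⁻ x, ‖fderiv ℝ v x‖ₑ ^ 2 < ⊤ :=
    lintegral_enorm_sq_lt_top_of_norm_le (fun x => (hDv_eq x).le) hv1
  have l2BDv : ∫⁻ x, ‖B • fderiv ℝ v x‖ₑ ^ 2 < ⊤ := by
    have : ∀ x, ‖B • fderiv ℝ v x‖ₑ ^ 2 = ‖B‖ₑ ^ 2 * ‖fderiv ℝ v x‖ₑ ^ 2 := fun x => by
      rw [enorm_smul, mul_pow]
    simp_rw [this]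
    rw [lintegral_const_mul' _ _ (by simp)]
    exact ENNReal.mul_lt_top (by simp) l2Dv
  have cgq : Continuous (gradient q) := by
    have : gradient q = fun x => (InnerProductSpace.toDual ℝ _).symm (fderiv ℝ q x) := rfl
    rw [this]
    exact (InnerProductSpace.toDual ℝ (EuclideanSpace ℝ (Fin 3))).symm.continuous.comp
      (hq.continuous_fderiv one_ne_zero)
  have n_gq : ∀ x, ‖gradient q x‖ = ‖iteratedFDeriv ℝ 1 q x‖ := fun x => by
    rw [gradient, LinearIsometryEquiv.norm_map, ← norm_iteratedFDeriv_fderiv, norm_iteratedFDeriv_zero]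
  have l2gq : ∫⁻ x, ‖gradient q x‖ₑ ^ 2 < ⊤ :=
    lintegral_enorm_sq_lt_top_of_norm_le (fun x => (n_gq x).le) hq1
  have cwt : ∀ {a : EuclideanSpace ℝ (Fin 3) → EuclideanSpace ℝ (Fin 3)}, Continuous a →
      Continuous fun x => ‖w x‖ ^ (θ - 2) * ⟪w x, a x⟫ := fun ha => cpow.mul (cwf.inner ha)
  have iΔ : Integrable (fun x => ‖w x‖ ^ (θ - 2) * ⟪w x, (Δ w) x⟫) volume :=
    integrable_of_norm_le_mul_of_lintegral_sq (cwt hΔc).aestronglyMeasurable c3D2 cBw l2Δ l2Bw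
      fun x => (hwt _ x).trans (mul_le_mul_of_nonneg_right (n_Δ x) (norm_nonneg _))
  have ic : Integrable (fun x => ‖w x‖ ^ (θ - 2) * ⟪w x, FluidPDE.convect v w x⟫) volume :=
    integrable_of_norm_le_mul_of_lintegral_sq (cwt cconv).aestronglyMeasurable cBDv cBw l2BDv l2Bw
      fun x => (hwt _ x).trans (mul_le_mul_of_nonneg_right (n_conv x) (norm_nonneg _))
  have ig : Integrable (fun x => ‖w x‖ ^ (θ - 2) * ⟪w x, gradient q x⟫) volume :=
    integrable_of_norm_le_mul_of_lintegral_sq (cwt cgq).aestronglyMeasurable cgq cBw l2gq l2Bw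
      fun x => hwt _ x
  -- integrate
  have hsplit : ∫ x, θ * ‖w x‖ ^ (θ - 2) * ⟪w x, W x⟫ =
      θ * (ν * (∫ x, ‖w x‖ ^ (θ - 2) * ⟪w x, (Δ w) x⟫) -
        (∫ x, ‖w x‖ ^ (θ - 2) * ⟪w x, FluidPDE.convect v w x⟫) -
        ∫ x, ‖w x‖ ^ (θ - 2) * ⟪w x, gradient q x⟫) := by
    have iA : Integrable (fun x => ν * (‖w x‖ ^ (θ - 2) * ⟪w x, (Δ w) x⟫)) volume :=
      iΔ.const_mul ν
    have iAB : Integrable (fun x => ν * (‖w x‖ ^ (θ - 2) * ⟪w x, (Δ w) x⟫) -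
        ‖w x‖ ^ (θ - 2) * ⟪w x, FluidPDE.convect v w x⟫) volume := iA.sub ic
    rw [integral_congr_ae (Eventually.of_forall hpt), integral_const_mul,
      integral_sub iAB ig, integral_sub iA ic, integral_const_mul]
  rw [hsplit, hI1, hI2, hI3]
  ring

end VerticalSlice

end Literature.Analysis.FluidPDE

end
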